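import Mathlib.Data.Nat.Choose.Sum
import Mathlib.Data.Real.Basic
import Mathlib.Tactic.FieldSimp
import Mathlib.Tactic.Positivity
import Mathlib.Tactic.Linarith
import Mathlib.Tactic.IntervalCases
import Mathlib.Tactic.Ring
import HarnessLib

/-!
# Jerrum–Snir's weight recurrence for the permanent (J. ACM 29 (1982), Lemma 3.6, §4.3)

The arithmetic half of §4.3 of

* [JerrumSnir1982] M. Jerrum, M. Snir, *Some exact complexity results for straight-line
  computations over semirings*, J. ACM 29 (1982) 874–897:

for the permanent's content bound `δ(r, d) = d! (r-d)! (n-r)!` (`perDelta n r d`) and the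
weight function `w(r) = Σ_{i=2}^{r} 1/((i-1)! (n-i)!)` (`perWeight n r`, the solution (3.6) of
the recurrence (3.3)–(3.4)),

* `JerrumSnir.choose_add_ge` — JS Lemma 4.1: `C(q+t, t) ≥ t (q+1)` for `q ≥ 2`;
* `JerrumSnir.js35_core`, `JerrumSnir.js35` — condition (3.5) for the permanent,
  `1/δ(r,d) + 1/δ(r-d,1) ≤ 1/δ(r,d+1) + 1/δ(d+1,1)` for `1 ≤ d`, `2d + 2 ≤ r ≤ n`, proved as in
  JS p. 888: with `s = r - 2d`, `t = n - r` it is `f(t,d,s) ≥ 0` for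
  `f = 1 + (d+1)/C(d+s+t-1,t) - (d+1)/(d+s) - (d+1)/C(t+d,t)`, `f` is increasing in `s`
  (Lemma 4.1), and `f(t,d,2) ≥ 0` (three cases);
* `JerrumSnir.perWeight_rec` — the recurrence inequality
  `w(r) ≤ w(d) + w(r-d) + 1/δ(r,d)` for `1 ≤ d < r ≤ n` (JS Thm. 3.4 / Lemma 3.6: by (3.5) the
  function `d ↦ w(d) + w(r-d) + 1/δ(r,d)` is increasing on `1 ≤ d ≤ r/2`, it is symmetric, and
  its value at `d = 1` is `w(r)`) — this is the hypothesis `JerrumSnir.WeightBound n (perDelta n)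
  (perWeight n)` of the general lower bound of `MonotoneGapParseTrees.lean` (assembled in
  `MonotoneGapProofs.lean`; this file is deliberately Mathlib-only);
* `JerrumSnir.factorial_mul_perWeight` — `n! · w(n) = n (2^{n-1} - 1)` (JS p. 889:
  `w(n) = (2^{n-1} - 1)/(n-1)!`).
-/

noncomputable section

namespace Literature.Barriers.ValiantsHypothesis

namespace JerrumSnir

open Finset Nat

/-! ### The content bound and the weight function of the permanent -/

/-- JS's content bound for the `n × n` permanent: `δ(r, d) = d! (r - d)! (n - r)!`, the number
of permutations respecting a partition of the rows into blocks of sizes `d`, `r - d`, `n - r`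
(as a real number). [cite: JerrumSnir1982, §4.3 (p. 888)] -/
def perDelta (n r d : ℕ) : ℝ :=
  ((d ! * (r - d)! * (n - r)! : ℕ) : ℝ)

/-- `δ > 0`. [folklore] -/
theorem perDelta_pos (n r d : ℕ) : 0 < perDelta n r d := by
  unfold perDelta
  exact_mod_cast Nat.pos_of_ne_zero (by positivity)

/-- `δ(r, r - d) = δ(r, d)`. [cite: JerrumSnir1982, §4.3] -/
theorem perDelta_symm {n r d : ℕ} (h : d ≤ r) : perDelta n r (r - d) = perDelta n r d := by
  unfold perDelta
  rw [Nat.sub_sub_self h]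
  push_cast
  ring

/-- JS's weight function for the `n × n` permanent, `w(r) = Σ_{i=2}^{r} 1/((i-1)! (n-i)!)`
(written as a sum over `k = i - 2 < r - 1`), the solution (3.6) of the recurrence (3.3)–(3.4)
for `δ = perDelta n`; `w(0) = w(1) = 0`. [cite: JerrumSnir1982, (3.6) and §4.3 (p. 889)] -/
def perWeight (n r : ℕ) : ℝ :=
  ∑ k ∈ Finset.range (r - 1), 1 / (((k + 1)! * (n - (k + 2))! : ℕ) : ℝ)

/-- `w(0) = 0`. [cite: JerrumSnir1982, (3.3)] -/
@[simp] theorem perWeight_zero (n : ℕ) : perWeight n 0 = 0 := by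
  simp [perWeight]

/-- `w(1) = 0`. [cite: JerrumSnir1982, (3.3)] -/
@[simp] theorem perWeight_one (n : ℕ) : perWeight n 1 = 0 := by
  simp [perWeight]

/-- `w(r + 1) = w(r) + 1/(r! (n-r-1)!)` for `r ≥ 1`. [cite: JerrumSnir1982, (3.6)] -/
theorem perWeight_succ (n : ℕ) {r : ℕ} (hr : 1 ≤ r) :
    perWeight n (r + 1) = perWeight n r + 1 / ((r ! * (n - (r + 1))! : ℕ) : ℝ) := by
  unfold perWeight
  rw [Nat.add_sub_cancel, show r = (r - 1) + 1 from (Nat.sub_add_cancel hr).symm,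
    Finset.sum_range_succ, Nat.add_sub_cancel]

/-- `w ≥ 0`. [folklore] -/
theorem perWeight_nonneg (n r : ℕ) : 0 ≤ perWeight n r :=
  Finset.sum_nonneg fun _ _ => by positivity

/-! ### JS Lemma 4.1 and the two integer inequalities behind (3.5) -/

/-- `C(n, j+1) ≥ n` for `1 ≤ j + 1 ≤ n - 1`. [folklore] -/
theorem le_choose_succ : ∀ n j : ℕ, j + 2 ≤ n → n ≤ n.choose (j + 1)
  | 0, j, h => by omega
  | n + 1, j, h => by
    rcases Nat.eq_zero_or_pos j with rfl | hj
    · simp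
    · by_cases hjn : j + 1 = n
      · subst hjn
        rw [Nat.choose_succ_self_right]
      · have h1 := le_choose_succ n (j - 1) (by omega)
        have h2 := le_choose_succ n j (by omega)
        rw [show j - 1 + 1 = j by omega] at h1
        rw [Nat.choose_succ_succ']
        omega

/-- **JS Lemma 4.1**: `C(q + t, t) ≥ t (q + 1)` for `q ≥ 2` (and `t ≥ 1`; trivially for
`t = 0`). [cite: JerrumSnir1982, Lemma 4.1] -/
theorem choose_add_ge {q : ℕ} (hq : 2 ≤ q) : ∀ {t : ℕ}, 1 ≤ t → t * (q + 1) ≤ (q + t).choose t := by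
  intro t ht
  induction t, ht using Nat.le_induction with
  | base => simp
  | succ t ht ih =>
    rw [show q + (t + 1) = (q + t) + 1 by ring, Nat.choose_succ_succ']
    have h := le_choose_succ (q + t) t (by omega)
    nlinarith

/-- The integer inequality behind both the base case `s = 2` and the monotonicity step of
JS's verification of (3.5): `t (q+1) (q+2) ≤ (q+t+1) C(q+t, t)` for `q, t ≥ 1` (for `q ≥ 2` by
Lemma 4.1, for `q = 1` it reads `6t ≤ (t+1)(t+2)`). [cite: JerrumSnir1982, §4.3 (p. 888)] -/
theorem key_ineq {q t : ℕ} (hq : 1 ≤ q) (ht : 1 ≤ t) :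
    t * (q + 1) * (q + 2) ≤ (q + t + 1) * (q + t).choose t := by
  rcases Nat.lt_or_ge q 2 with hq1 | hq2
  · have hq' : q = 1 := by omega
    subst hq'
    rw [show 1 + t = t + 1 by ring, Nat.choose_succ_self_right]
    rcases Nat.lt_or_ge t 3 with ht3 | ht3
    · interval_cases t <;> norm_num
    · nlinarith
  · have h := choose_add_ge hq2 ht
    calc t * (q + 1) * (q + 2) ≤ (q + t).choose t * (q + 2) := Nat.mul_le_mul_right _ h
      _ ≤ (q + t).choose t * (q + t + 1) := Nat.mul_le_mul_left _ (by omega)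
      _ = (q + t + 1) * (q + t).choose t := by ring

/-! ### Condition (3.5) for the permanent -/

/-- The function `f` of JS p. 888 is nonnegative: for `d ≥ 1`, `m ≥ d + 1` (`m = d + s - 1`,
`s ≥ 2`) and every `t`, `(d+1)/(m+1) + (d+1)/C(d+t,t) ≤ 1 + (d+1)/C(m+t,t)`; for `t ≥ 1` the
right-hand side minus `(d+1)/(m+1)` is increasing in `m` (Lemma 4.1) and the case `m = d + 1`
is `key_ineq`; for `t = 0` it is `d + 1 ≤ m + 1`. [cite: JerrumSnir1982, §4.3 (p. 888)] -/
theorem f_nonneg {d m : ℕ} (hd : 1 ≤ d) (hm : d + 1 ≤ m) (t : ℕ) :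
    ((d : ℝ) + 1) / (m + 1) + (d + 1) / ((d + t).choose t : ℕ) ≤
      1 + (d + 1) / ((m + t).choose t : ℕ) := by
  rcases Nat.eq_zero_or_pos t with rfl | ht
  · simp only [Nat.add_zero, Nat.choose_zero_right, Nat.cast_one, div_one]
    have : ((d : ℝ) + 1) / (m + 1) ≤ 1 := by
      rw [div_le_one (by positivity)]
      exact_mod_cast Nat.succ_le_succ (by omega : d ≤ m)
    linarith
  · suffices h : ∀ m', d + 1 ≤ m' →
        ((d : ℝ) + 1) / ((d + t).choose t : ℕ) ≤
          1 + (d + 1) / ((m' + t).choose t : ℕ) - (d + 1) / (m' + 1) by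
      have := h m hm
      linarith
    intro m' hm'
    induction m', hm' using Nat.le_induction with
    | base =>
      -- `m' = d + 1`: the case `s = 2`
      set K : ℕ := (d + t).choose t with hK
      have hKpos : (0 : ℝ) < K := by exact_mod_cast Nat.choose_pos (Nat.le_add_left t d)
      have hid : ((d + 1 + t).choose t : ℝ) * (d + 1) = K * (d + t + 1) := by
        have h := Nat.choose_mul_succ_eq (d + t) t
        rw [show d + t + 1 - t = d + 1 by omega, show d + t + 1 = d + 1 + t by ring] at h
        rw [show (d : ℝ) + t + 1 = ((d + 1 + t : ℕ) : ℝ) by push_cast; ring]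
        exact_mod_cast h.symm
      have hK'pos : (0 : ℝ) < ((d + 1 + t).choose t : ℕ) := by
        exact_mod_cast Nat.choose_pos (Nat.le_add_left t (d + 1))
      have hrecip : ((d : ℝ) + 1) / ((d + 1 + t).choose t : ℕ) = (d + 1) ^ 2 / (K * (d + t + 1)) := by
        rw [div_eq_div_iff hK'pos.ne' (by positivity)]
        calc ((d : ℝ) + 1) * (K * (d + t + 1)) = (d + 1) * (((d + 1 + t).choose t : ℝ) * (d + 1)) := by
              rw [hid]
          _ = (d + 1) ^ 2 * ((d + 1 + t).choose t : ℕ) := by ring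
      have hkey : (t : ℝ) * (d + 1) * (d + 2) ≤ (d + t + 1) * K := by
        exact_mod_cast key_ineq hd ht
      rw [hrecip]
      have hexpr : 1 + ((d : ℝ) + 1) ^ 2 / (K * (d + t + 1)) - (d + 1) / ((d + 1 : ℕ) + 1) -
          (d + 1) / K = ((d + t + 1) * K - t * (d + 1) * (d + 2)) / (K * (d + t + 1) * (d + 2)) := by
        push_cast
        field_simp
        ring
      have : 0 ≤ 1 + ((d : ℝ) + 1) ^ 2 / (K * (d + t + 1)) - (d + 1) / ((d + 1 : ℕ) + 1) -
          (d + 1) / K := by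
        rw [hexpr]
        exact div_nonneg (by linarith) (by positivity)
      linarith
    | succ m' hm' ih =>
      -- monotonicity in `m'` (i.e. in `s`)
      set K : ℕ := (m' + t).choose t with hK
      have hKpos : (0 : ℝ) < K := by exact_mod_cast Nat.choose_pos (Nat.le_add_left t m')
      have hid : ((m' + 1 + t).choose t : ℝ) * (m' + 1) = K * (m' + t + 1) := by
        have h := Nat.choose_mul_succ_eq (m' + t) t
        rw [show m' + t + 1 - t = m' + 1 by omega, show m' + t + 1 = m' + 1 + t by ring] at h
        rw [show (m' : ℝ) + t + 1 = ((m' + 1 + t : ℕ) : ℝ) by push_cast; ring]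
        exact_mod_cast h.symm
      have hK'pos : (0 : ℝ) < ((m' + 1 + t).choose t : ℕ) := by
        exact_mod_cast Nat.choose_pos (Nat.le_add_left t (m' + 1))
      have hrecip : ((d : ℝ) + 1) / ((m' + 1 + t).choose t : ℕ) =
          (d + 1) * (m' + 1) / (K * (m' + t + 1)) := by
        rw [div_eq_div_iff hK'pos.ne' (by positivity)]
        calc ((d : ℝ) + 1) * (K * (m' + t + 1)) = (d + 1) * (((m' + 1 + t).choose t : ℝ) * (m' + 1)) := by
              rw [hid]
          _ = (d + 1) * (m' + 1) * ((m' + 1 + t).choose t : ℕ) := by ring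
      have hkey : (t : ℝ) * (m' + 1) * (m' + 2) ≤ (m' + t + 1) * K := by
        exact_mod_cast key_ineq (by omega : 1 ≤ m') ht
      rw [hrecip]
      have hexpr : (1 + ((d : ℝ) + 1) * (m' + 1) / (K * (m' + t + 1)) - (d + 1) / ((m' + 1 : ℕ) + 1)) -
          (1 + (d + 1) / K - (d + 1) / (m' + 1)) =
            (d + 1) * ((m' + t + 1) * K - t * (m' + 1) * (m' + 2)) /
              (K * (m' + t + 1) * (m' + 1) * (m' + 2)) := by
        push_cast
        field_simp
        ring
      have : 0 ≤ (1 + ((d : ℝ) + 1) * (m' + 1) / (K * (m' + t + 1)) - (d + 1) / ((m' + 1 : ℕ) + 1)) -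
          (1 + (d + 1) / K - (d + 1) / (m' + 1)) := by
        rw [hexpr]
        exact div_nonneg (mul_nonneg (by positivity) (by linarith)) (by positivity)
      linarith

/-- **Condition (3.5) for the permanent, core form**: for `d ≥ 1`, `m ≥ d + 1` and all `t`,
`1/(d! (m+1)! t!) + 1/(m! (t+d)!) ≤ 1/((d+1)! m! t!) + 1/(d! (m+t)!)`; this is (3.5) for
`δ = perDelta n` at `r = m + d + 1`, `n = r + t`, divided through as on JS p. 888.
[cite: JerrumSnir1982, §4.3 (p. 888)] -/
theorem js35_core {d m : ℕ} (hd : 1 ≤ d) (hm : d + 1 ≤ m) (t : ℕ) :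
    1 / ((d ! * (m + 1)! * t ! : ℕ) : ℝ) + 1 / ((m ! * (t + d)! : ℕ) : ℝ) ≤
      1 / (((d + 1)! * m ! * t ! : ℕ) : ℝ) + 1 / ((d ! * (m + t)! : ℕ) : ℝ) := by
  set K₁ : ℕ := (m + t).choose t with hK₁
  set K₂ : ℕ := (d + t).choose t with hK₂
  have hK₁pos : (0 : ℝ) < K₁ := by exact_mod_cast Nat.choose_pos (Nat.le_add_left t m)
  have hK₂pos : (0 : ℝ) < K₂ := by exact_mod_cast Nat.choose_pos (Nat.le_add_left t d)
  have hf1 : ((m + t)! : ℝ) = K₁ * t ! * m ! := by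
    have h := Nat.choose_mul_factorial_mul_factorial (Nat.le_add_left t m)
    rw [Nat.add_sub_cancel] at h
    exact_mod_cast h.symm
  have hf2 : ((t + d)! : ℝ) = K₂ * t ! * d ! := by
    have h := Nat.choose_mul_factorial_mul_factorial (Nat.le_add_left t d)
    rw [Nat.add_sub_cancel] at h
    rw [add_comm t d]
    exact_mod_cast h.symm
  have fineq := f_nonneg hd hm t
  rw [← hK₁, ← hK₂] at fineq
  have hd1 : (0 : ℝ) < d + 1 := by positivity
  push_cast [Nat.factorial_succ]
  rw [hf1, hf2]
  have lhs_eq : 1 / ((d ! : ℝ) * ((m + 1) * m !) * t !) + 1 / (m ! * (K₂ * t ! * d !)) =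
      (1 / (d ! * m ! * t !)) * (1 / (m + 1) + 1 / K₂) := by
    field_simp
  have rhs_eq : 1 / (((d : ℝ) + 1) * d ! * m ! * t !) + 1 / (d ! * (K₁ * t ! * m !)) =
      (1 / (d ! * m ! * t !)) * (1 / (d + 1) + 1 / K₁) := by
    field_simp
  rw [lhs_eq, rhs_eq]
  refine mul_le_mul_of_nonneg_left ?_ (by positivity)
  have h := div_le_div_of_nonneg_right fineq hd1.le
  have e1 : (((d : ℝ) + 1) / (m + 1) + (d + 1) / K₂) / (d + 1) = 1 / (m + 1) + 1 / K₂ := by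
    field_simp
  have e2 : (1 + ((d : ℝ) + 1) / K₁) / (d + 1) = 1 / (d + 1) + 1 / K₁ := by
    field_simp
  rwa [e1, e2] at h

/-- **Condition (3.5) for the permanent** (JS p. 888): for `1 ≤ d`, `2d + 2 ≤ r ≤ n`,
`1/δ(r, d) + 1/δ(r - d, 1) ≤ 1/δ(r, d + 1) + 1/δ(d + 1, 1)`. [cite: JerrumSnir1982, (3.5) and §4.3 (p. 888)] -/
theorem js35 {n r d : ℕ} (hd : 1 ≤ d) (hr : 2 * d + 2 ≤ r) (hrn : r ≤ n) :
    1 / perDelta n r d + 1 / perDelta n (r - d) 1 ≤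
      1 / perDelta n r (d + 1) + 1 / perDelta n (d + 1) 1 := by
  obtain ⟨m, rfl⟩ : ∃ m, r = m + d + 1 := ⟨r - d - 1, by omega⟩
  obtain ⟨t, rfl⟩ : ∃ t, n = m + d + 1 + t := ⟨n - (m + d + 1), by omega⟩
  have h := js35_core hd (by omega : d + 1 ≤ m) t
  unfold perDelta
  rw [show m + d + 1 - d = m + 1 by omega, show m + d + 1 + t - (m + d + 1) = t by omega,
    show m + 1 - 1 = m by omega, show m + d + 1 + t - (m + 1) = t + d by omega,
    show m + d + 1 - (d + 1) = m by omega, show d + 1 - 1 = d by omega,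
    show m + d + 1 + t - (d + 1) = m + t by omega, Nat.factorial_one, one_mul, one_mul]
  exact h

/-! ### The recurrence inequality for `w` (JS Thm. 3.4 / Lemma 3.6) -/

/-- **The recurrence (3.4) with `≤` for the permanent's `δ` and `w`**: for `1 ≤ d < r ≤ n`,
`w(r) ≤ w(d) + w(r - d) + 1/δ(r, d)`. Proof as in JS Lemma 3.6: the right-hand side is symmetric
under `d ↦ r - d`, increasing in `d` on `1 ≤ d ≤ r/2` by (3.5), and equal to `w(r)` at `d = 1`.
[cite: JerrumSnir1982, Thm. 3.4, Lemma 3.6 and §4.3] -/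
theorem perWeight_rec {n r d : ℕ} (hd : 1 ≤ d) (hdr : d < r) (hrn : r ≤ n) :
    perWeight n r ≤ perWeight n d + perWeight n (r - d) + 1 / perDelta n r d := by
  wlog h2 : 2 * d ≤ r generalizing d
  · have h := this (d := r - d) (by omega) (by omega) (by omega)
    rw [Nat.sub_sub_self hdr.le, perDelta_symm hdr.le] at h
    linarith
  -- the value at `d = 1`
  have hg1 : perWeight n r = perWeight n 1 + perWeight n (r - 1) + 1 / perDelta n r 1 := by
    rw [perWeight_one, zero_add]
    obtain ⟨r', rfl⟩ : ∃ r', r = r' + 1 := ⟨r - 1, by omega⟩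
    rw [Nat.add_sub_cancel, perWeight_succ n (by omega : 1 ≤ r')]
    unfold perDelta
    rw [Nat.factorial_one, one_mul, Nat.add_sub_cancel]
  -- monotonicity in `d` on `1 ≤ d ≤ r/2`, from (3.5)
  have hmono : ∀ e : ℕ, 1 ≤ e → 2 * (e + 1) ≤ r →
      perWeight n e + perWeight n (r - e) + 1 / perDelta n r e ≤
        perWeight n (e + 1) + perWeight n (r - (e + 1)) + 1 / perDelta n r (e + 1) := by
    intro e he her
    have h35 := js35 (n := n) he (by omega) hrn
    have hw1 : perWeight n (e + 1) = perWeight n e + 1 / perDelta n (e + 1) 1 := by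
      rw [perWeight_succ n he]
      unfold perDelta
      rw [Nat.factorial_one, one_mul, Nat.add_sub_cancel]
    have hw2 : perWeight n (r - e) = perWeight n (r - (e + 1)) + 1 / perDelta n (r - e) 1 := by
      have hre : r - e = (r - (e + 1)) + 1 := by omega
      rw [hre, perWeight_succ n (by omega : 1 ≤ r - (e + 1))]
      unfold perDelta
      rw [Nat.factorial_one, one_mul, Nat.add_sub_cancel]
    linarith
  have hind : ∀ e : ℕ, 1 ≤ e → 2 * e ≤ r →
      perWeight n 1 + perWeight n (r - 1) + 1 / perDelta n r 1 ≤
        perWeight n e + perWeight n (r - e) + 1 / perDelta n r e := by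
    intro e he
    induction e, he using Nat.le_induction with
    | base => intro; exact le_rfl
    | succ e he ih => intro h; exact (ih (by omega)).trans (hmono e he h)
  rw [hg1]
  exact hind d hd h2

/-! ### The value `n! · w(n) = n (2^{n-1} - 1)` -/

/-- `Σ_{k < n-1} C(n-1, k+1) = 2^{n-1} - 1`. [folklore] -/
theorem sum_range_choose_succ (n : ℕ) :
    ∑ k ∈ Finset.range (n - 1), ((n - 1).choose (k + 1) : ℝ) = 2 ^ (n - 1) - 1 := by
  have h := Nat.sum_range_choose (n - 1)
  rw [Finset.sum_range_succ'] at h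
  simp only [Nat.choose_zero_right] at h
  have h' : ((∑ k ∈ Finset.range (n - 1), (n - 1).choose (k + 1) + 1 : ℕ) : ℝ) = (2 ^ (n - 1) : ℕ) := by
    exact_mod_cast h
  push_cast at h'
  linarith

/-- **`n! · w(n) = n (2^{n-1} - 1)`** (JS p. 889: `w(n) = Σ_{i=2}^{n} 1/((i-1)!(n-i)!) =
(2^{n-1} - 1)/(n-1)!`, times `|mon(per)| = n!`). [cite: JerrumSnir1982, §4.3 (p. 889)] -/
theorem factorial_mul_perWeight {n : ℕ} (hn : 1 ≤ n) :
    (n ! : ℝ) * perWeight n n = n * (2 ^ (n - 1) - 1) := by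
  unfold perWeight
  rw [Finset.mul_sum]
  have hterm : ∀ k ∈ Finset.range (n - 1),
      (n ! : ℝ) * (1 / (((k + 1)! * (n - (k + 2))! : ℕ) : ℝ)) = n * ((n - 1).choose (k + 1) : ℝ) := by
    intro k hk
    rw [Finset.mem_range] at hk
    have h := Nat.choose_mul_factorial_mul_factorial (show k + 1 ≤ n - 1 by omega)
    rw [show n - 1 - (k + 1) = n - (k + 2) by omega] at h
    have h3 : (n ! : ℝ) = n * (n - 1)! := by
      rw [← Nat.mul_factorial_pred (by omega : n ≠ 0)]
      push_cast
      ring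
    have hpos : (0 : ℝ) < ((k + 1)! * (n - (k + 2))! : ℕ) := by positivity
    rw [h3, mul_one_div, div_eq_iff hpos.ne', show ((n - 1)! : ℝ) = ((n - 1).choose (k + 1) *
      (k + 1)! * (n - (k + 2))! : ℕ) by exact_mod_cast h.symm]
    push_cast
    ring
  rw [Finset.sum_congr rfl hterm, ← Finset.mul_sum, sum_range_choose_succ n]

/-- The same value as a natural number cast: `n! · w(n) = ↑(n (2^{n-1} - 1))`.
[cite: JerrumSnir1982, §4.3 (p. 889)] -/
theorem factorial_mul_perWeight_eq_natCast {n : ℕ} (hn : 1 ≤ n) :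
    (n ! : ℝ) * perWeight n n = ((n * (2 ^ (n - 1) - 1) : ℕ) : ℝ) := by
  rw [factorial_mul_perWeight hn, Nat.cast_mul, Nat.cast_sub Nat.one_le_two_pow]
  push_cast
  ring

end JerrumSnir

end Literature.Barriers.ValiantsHypothesis
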